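import Mathlib
import HarnessLib
import Summits.HubbardSuperconductivity.HubbardSuperconductivity.Theorems.KLProgrammeLatticeSoftPartnerSignBlind

/-!
# Route `KLProgramme` — crux K3, ENGINE child gen 6 (stmt-HubbardSuperconductivity-20236 `KLRegimeEngineV16`), stub `stub_engine_step_values`,
# (E2-v10) ph-loop inputs: the FREQUENCY PROFILE `min(1, 8Λ_n/|q₀|)` of the sign-blind slice ⊗ soft bubble — per ray, on the plane, and on the
# model carrier `MatsubaraIdx M × TorusSite 2 L` (cell gate-hubbard-kl, seat hubbard-kl-k3c2-p2 g7)

Sequel to `…MatsubaraSoftPartnerSignBlind` / `…PlanarSoftPartnerSignBlind` / `…LatticeSoftPartnerSignBlind`: the same chain with the profile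
lemma `klhs_slice_soft_signblind_profile_le` (`m₀ ≠ 0`: `O(1)` up to `|q₀| ≍ Λ_n`, then the decay `Λ_n/|q₀|`) in place of the uniform bound.

* `klhs_slice_soft_signblind_profile_le_window` (the profile lemma with the shifts `½`-Lipschitz on the window only — clamp device);
* `klhp_ray_soft_signblind_profile_le`, `klhp_planar_soft_signblind_profile_le`;
* **`klhl_lattice_soft_of_planar_bound`** — the lattice step ALONE: any planar bound `Bp` on the cut-off family ⇒ lattice `≤ (2π)⁻²·Bp + 32Λ_n·K/L`
  (so every future planar variant transfers in one line), and **`klhl_lattice_soft_signblind_profile_le`**: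
  `‖β⁻¹ • Σ_i L⁻² • Σ_k a_i Φ_f Φ_d‖ ≤ (2π)⁻²·(2π·(512/π)·M_f·(A₀π√2/d)·M′·min(1, 8Λ_n/|2πm₀/β|)) + 32Λ_n·K/L`.

Pure analysis; nothing about the model's effective action is asserted; nothing asserts superconductivity.
-/

noncomputable section

namespace Summit.HubbardSuperconductivity.HubbardSuperconductivity.Theorems.KLRegimeSplit

set_option linter.dupNamespace false -- summit = problem name (single-conjunct summit), D-0017

open Real Set Filter MeasureTheory Complex Literature.MathematicalPhysics.QuantumLattice Literature.Probability.LatticeModels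
open Literature.MathematicalPhysics.QuantumLattice.BandSectorCounting
open Summit.HubbardSuperconductivity.HubbardSuperconductivity.Theorems.PerturbedFermiCurve
open Summit.HubbardSuperconductivity.HubbardSuperconductivity.Theorems.KLProgrammeLegKernels
open scoped NNReal

/-! ## §1 The profile lemma in window form -/

section Window

variable {f : ℝ → ℂ} {Mf : ℝ}

/-- **Window form of the frequency profile**: shifts `½`-Lipschitz on `[−4Λ_n, 4Λ_n]` only; `m₀ ≠ 0` ⇒
`‖β⁻¹ • Σ_i ∫ Φ_f(ω_i,e)·G_i(e) de‖ ≤ (512/π)·M_f·B·min(1, 8Λ_n/|2πm₀/β|)`. -/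
theorem klhs_slice_soft_signblind_profile_le_window (hbd : ∀ s, ‖f s‖ ≤ Mf) {n : ℕ}
    (hin : ∀ s, s ≤ (klScale klE0 n / 2) ^ 2 → f s = 0) (hout : ∀ s, (4 * klScale klE0 n) ^ 2 ≤ s → f s = 0)
    {M : ℕ} {β : ℝ} (hβ : klBetaMin ≤ β) (hn : n ≤ nScales β + 1) {m₀ : ℤ} (hm₀ : m₀ ≠ 0)
    {σ : MatsubaraIdx M → ℝ → ℝ}
    (hσ : ∀ i, ∀ e ∈ Set.Icc (-(4 * klScale klE0 n)) (4 * klScale klE0 n), ∀ e' ∈ Set.Icc (-(4 * klScale klE0 n)) (4 * klScale klE0 n),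
      |σ i e - σ i e'| ≤ |e - e'| / 2)
    {G : MatsubaraIdx M → ℝ → ℂ} {B : ℝ} (hB : 0 ≤ B)
    (hG : ∀ i e, |e| < 4 * klScale klE0 n →
      ‖G i e‖ ≤ B / Real.sqrt ((Real.pi * (2 * ((matsubaraInt M i + m₀ : ℤ) : ℝ) + 1) / β) ^ 2 + (e + σ i e) ^ 2)) :
    ‖β⁻¹ • ∑ i : MatsubaraIdx M, ∫ e,
        (f (matsubaraFreq β M i ^ 2 + e ^ 2) / (((matsubaraFreq β M i ^ 2 + e ^ 2 : ℝ)) : ℂ) * (I * (matsubaraFreq β M i) + e)) * G i e‖ ≤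
      512 / Real.pi * Mf * B * min 1 (8 * klScale klE0 n / |2 * Real.pi * (m₀ : ℝ) / β|) := by
  set R := 4 * klScale klE0 n with hR
  have hR0 : 0 ≤ R := by have := klth_klScale_pos n; positivity
  have hmem : ∀ e : ℝ, max (-R) (min e R) ∈ Set.Icc (-R) R := fun e =>
    ⟨le_max_left _ _, max_le (by linarith) (min_le_right _ _)⟩
  refine klhs_slice_soft_signblind_profile_le hbd hin hout hβ hn hm₀ (σ := fun i e => σ i (max (-R) (min e R)))
    (fun i e e' => ?_) hB (fun i e he => ?_)
  · exact (hσ i _ (hmem e) _ (hmem e')).trans (by linarith [klhs_clamp_lipschitz R e e'])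
  · rw [klhs_clamp_eq_self he]
    exact hG i e he

end Window

/-! ## §2 Per ray and on the plane -/

section Frame

variable {a b : ℝ} (B : BandBounds a b) {δ : (Fin 2 → ℝ) → ℝ} (hδ1 : ContDiff ℝ 1 δ) {κ₀ κ₁ : ℝ}
  (hδ : ∀ k : Fin 2 → ℝ, (∀ i, |k i| ≤ π) → |δ k| ≤ κ₀)
  (hκ : ∀ k : Fin 2 → ℝ, (∀ i, |k i| ≤ π) → ‖fderiv ℝ δ k‖ ≤ κ₁) (hκ₁ : κ₁ < B.Dtmin)

include B hδ1 hδ hκ hκ₁ in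
/-- **PER-RAY frequency profile** (as `klhp_ray_soft_signblind_norm_le`, `m₀ ≠ 0`, bound × `min(1, 8Λ_n/|q₀|)`). -/
theorem klhp_ray_soft_signblind_profile_le {M : ℕ} {A : MatsubaraIdx M → ℝ × ℝ → ℂ} (hA : ∀ i, Continuous (A i))
    (hAsupp : ∀ i, ∀ p : ℝ × ℝ, A i p ≠ 0 → |p.1| < π ∧ |p.2| < π) {A₀ : ℝ} (hA00 : 0 ≤ A₀) (hA0 : ∀ i p, ‖A i p‖ ≤ A₀)
    {f d : ℝ → ℂ} {Lf Mf Ld M' : ℝ} {n : ℕ}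
    (hlip : ∀ s s', ‖f s - f s'‖ ≤ Lf * |s - s'|) (hbd : ∀ s, ‖f s‖ ≤ Mf)
    (hin : ∀ s, s ≤ (klScale klE0 n / 2) ^ 2 → f s = 0) (hout : ∀ s, (4 * klScale klE0 n) ^ 2 ≤ s → f s = 0)
    (hdlip : ∀ s s', ‖d s - d s'‖ ≤ Ld * |s - s'|) (hdbd : ∀ s, ‖d s‖ ≤ M')
    {e' : ℝ × ℝ → ℝ} (he' : Continuous e') {μ : ℝ} (θ : ℝ)
    (hσ : ∀ e ∈ Icc (-(4 * klScale klE0 n)) (4 * klScale klE0 n), ∀ e'' ∈ Icc (-(4 * klScale klE0 n)) (4 * klScale klE0 n),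
      |klfb_shift δ μ e' θ e - klfb_shift δ μ e' θ e''| ≤ |e - e''| / 2)
    (hlo : a < μ - 4 * klScale klE0 n - κ₀) (hhi : μ + 4 * klScale klE0 n + κ₀ < b)
    {β : ℝ} (hβ : klBetaMin ≤ β) (hn : n ≤ nScales β + 1) {m₀ : ℤ} (hm₀ : m₀ ≠ 0) :
    ‖β⁻¹ • ∑ i : MatsubaraIdx M, ∫ t in Ioi (0 : ℝ),
        t • klfb_integrand δ μ (A i) f d e' (matsubaraFreq β M i) (2 * Real.pi * (m₀ : ℝ) / β) (t * Real.cos θ, t * Real.sin θ)‖ ≤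
      512 / Real.pi * Mf * (A₀ * (Real.pi * Real.sqrt 2 / (B.Dtmin - κ₁)) * M') *
        min 1 (8 * klScale klE0 n / |2 * Real.pi * (m₀ : ℝ) / β|) := by
  have hδc : Continuous δ := hδ1.continuous
  have hΛ := klth_klScale_pos n
  have hβ0 : 0 < β := pos_of_klBetaMin_le hβ
  have hr₁ : 0 < klScale klE0 n / 2 := by positivity
  have hr : 0 < 4 * klScale klE0 n := by positivity
  have hd0 : 0 < B.Dtmin - κ₁ := by linarith
  have hM' : 0 ≤ M' := (norm_nonneg _).trans (hdbd 0)
  have hB0 : 0 ≤ A₀ * (Real.pi * Real.sqrt 2 / (B.Dtmin - κ₁)) * M' := by positivity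
  set q₀ : ℝ := 2 * Real.pi * (m₀ : ℝ) / β with hq₀
  -- the partner frequency is fermionic, hence nonzero
  have hν : ∀ i : MatsubaraIdx M, matsubaraFreq β M i + q₀ = Real.pi * (2 * ((matsubaraInt M i + m₀ : ℤ) : ℝ) + 1) / β :=
    fun i => klhp_matsubaraFreq_add_bosonic β M i m₀
  have hν0 : ∀ i : MatsubaraIdx M, matsubaraFreq β M i + q₀ ≠ 0 := by
    intro i
    rw [hν i]
    have hodd : (2 * ((matsubaraInt M i + m₀ : ℤ) : ℝ) + 1) ≠ 0 := by
      have h : (2 * (matsubaraInt M i + m₀) + 1 : ℤ) ≠ 0 := by omega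
      exact_mod_cast h
    exact div_ne_zero (mul_ne_zero Real.pi_pos.ne' hodd) hβ0.ne'
  -- per ray, in level coordinates
  have hray : ∀ i : MatsubaraIdx M,
      ∫ t in Ioi (0 : ℝ), t • klfb_integrand δ μ (A i) f d e' (matsubaraFreq β M i) q₀ (t * Real.cos θ, t * Real.sin θ) =
        ∫ e : ℝ, (f (matsubaraFreq β M i ^ 2 + e ^ 2) / (((matsubaraFreq β M i ^ 2 + e ^ 2 : ℝ)) : ℂ) * (I * (matsubaraFreq β M i) + e)) *
          (klfb_weight δ μ (A i) θ e * klfb_prop d (matsubaraFreq β M i + q₀) (e + klfb_shift δ μ e' θ e)) := by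
    intro i
    rw [klhp_ray_integral_eq B hδ1 hδ hκ hκ₁ (hA i) (hAsupp i) hlip hbd hin hout hr₁ hr hdlip he' hlo hhi (hν0 i) θ]
    congr 1
    funext e
    rw [klfb_prop_apply f]
    ring
  -- the partner hypothesis of `klhs_…_window`
  have hG : ∀ (i : MatsubaraIdx M) (e : ℝ), |e| < 4 * klScale klE0 n →
      ‖klfb_weight δ μ (A i) θ e * klfb_prop d (matsubaraFreq β M i + q₀) (e + klfb_shift δ μ e' θ e)‖ ≤
        A₀ * (Real.pi * Real.sqrt 2 / (B.Dtmin - κ₁)) * M' /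
          Real.sqrt ((Real.pi * (2 * ((matsubaraInt M i + m₀ : ℤ) : ℝ) + 1) / β) ^ 2 + (e + klfb_shift δ μ e' θ e) ^ 2) := by
    intro i e he
    have habs := abs_lt.mp he
    have hlo' : a ≤ μ + e - κ₀ := by linarith [habs.1]
    have hhi' : μ + e + κ₀ ≤ b := by linarith [habs.2]
    have hW := klfb_weight_norm_le B hδ hκ hκ₁ hδc (hA0 i) hlo' hhi' θ
    have hD := klhs_soft_propagator_norm_le hdbd (hν0 i) (e + klfb_shift δ μ e' θ e)
    rw [norm_mul, klfb_prop_apply, ← hν i]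
    have hW0 : 0 ≤ A₀ * (Real.pi * Real.sqrt 2 / (B.Dtmin - κ₁)) := by positivity
    calc ‖klfb_weight δ μ (A i) θ e‖ *
          ‖d ((matsubaraFreq β M i + q₀) ^ 2 + (e + klfb_shift δ μ e' θ e) ^ 2) /
              ((((matsubaraFreq β M i + q₀) ^ 2 + (e + klfb_shift δ μ e' θ e) ^ 2 : ℝ)) : ℂ) *
            (I * ((matsubaraFreq β M i + q₀ : ℝ) : ℂ) + ((e + klfb_shift δ μ e' θ e : ℝ) : ℂ))‖
        ≤ (A₀ * (Real.pi * Real.sqrt 2 / (B.Dtmin - κ₁))) *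
            (M' / Real.sqrt ((matsubaraFreq β M i + q₀) ^ 2 + (e + klfb_shift δ μ e' θ e) ^ 2)) :=
          mul_le_mul hW hD (norm_nonneg _) hW0
      _ = A₀ * (Real.pi * Real.sqrt 2 / (B.Dtmin - κ₁)) * M' /
            Real.sqrt ((matsubaraFreq β M i + q₀) ^ 2 + (e + klfb_shift δ μ e' θ e) ^ 2) := by ring
  have key := klhs_slice_soft_signblind_profile_le_window hbd hin hout hβ hn hm₀ (σ := fun _ : MatsubaraIdx M => klfb_shift δ μ e' θ)
    (fun _ e he e'' he'' => hσ e he e'' he'')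
    (G := fun i e => klfb_weight δ μ (A i) θ e * klfb_prop d (matsubaraFreq β M i + q₀) (e + klfb_shift δ μ e' θ e)) hB0 hG
  calc ‖β⁻¹ • ∑ i : MatsubaraIdx M, ∫ t in Ioi (0 : ℝ),
          t • klfb_integrand δ μ (A i) f d e' (matsubaraFreq β M i) q₀ (t * Real.cos θ, t * Real.sin θ)‖
      = ‖β⁻¹ • ∑ i : MatsubaraIdx M, ∫ e : ℝ,
          (f (matsubaraFreq β M i ^ 2 + e ^ 2) / (((matsubaraFreq β M i ^ 2 + e ^ 2 : ℝ)) : ℂ) * (I * (matsubaraFreq β M i) + e)) *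
            (klfb_weight δ μ (A i) θ e * klfb_prop d (matsubaraFreq β M i + q₀) (e + klfb_shift δ μ e' θ e))‖ := by
        rw [Finset.sum_congr rfl fun i _ => hray i]
    _ ≤ 512 / Real.pi * Mf * (A₀ * (Real.pi * Real.sqrt 2 / (B.Dtmin - κ₁)) * M') *
        min 1 (8 * klScale klE0 n / |2 * Real.pi * (m₀ : ℝ) / β|) := key

include B hδ1 hδ hκ hκ₁ in
/-- **PLANAR frequency profile** (as `klhp_planar_soft_signblind_norm_le`, `m₀ ≠ 0`, bound × `min(1, 8Λ_n/|q₀|)`) (angle integration of `klhp_ray_soft_signblind_norm_le`,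
the ray shift `½`-Lipschitz on the window for every angle):
`‖β⁻¹ • Σ_i ∫ d²p A_i(p)·Φ_f(ω_i, e(p))·Φ_d(ω_i + 2πm₀/β, e′(p))‖ ≤ 2π·(512/π)·M_f·(A₀·π√2/(Dt_min − κ₁))·M′`. -/
theorem klhp_planar_soft_signblind_profile_le {M : ℕ} {A : MatsubaraIdx M → ℝ × ℝ → ℂ} (hA : ∀ i, Continuous (A i))
    (hAsupp : ∀ i, ∀ p : ℝ × ℝ, A i p ≠ 0 → |p.1| < π ∧ |p.2| < π) {A₀ : ℝ} (hA00 : 0 ≤ A₀) (hA0 : ∀ i p, ‖A i p‖ ≤ A₀)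
    {f d : ℝ → ℂ} {Lf Mf Ld M' : ℝ} {n : ℕ}
    (hlip : ∀ s s', ‖f s - f s'‖ ≤ Lf * |s - s'|) (hbd : ∀ s, ‖f s‖ ≤ Mf)
    (hin : ∀ s, s ≤ (klScale klE0 n / 2) ^ 2 → f s = 0) (hout : ∀ s, (4 * klScale klE0 n) ^ 2 ≤ s → f s = 0)
    (hdlip : ∀ s s', ‖d s - d s'‖ ≤ Ld * |s - s'|) (hdbd : ∀ s, ‖d s‖ ≤ M')
    {e' : ℝ × ℝ → ℝ} (he' : Continuous e') {μ : ℝ}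
    (hσ : ∀ θ : ℝ, ∀ e ∈ Icc (-(4 * klScale klE0 n)) (4 * klScale klE0 n), ∀ e'' ∈ Icc (-(4 * klScale klE0 n)) (4 * klScale klE0 n),
      |klfb_shift δ μ e' θ e - klfb_shift δ μ e' θ e''| ≤ |e - e''| / 2)
    (hlo : a < μ - 4 * klScale klE0 n - κ₀) (hhi : μ + 4 * klScale klE0 n + κ₀ < b)
    {β : ℝ} (hβ : klBetaMin ≤ β) (hn : n ≤ nScales β + 1) {m₀ : ℤ} (hm₀ : m₀ ≠ 0) :
    ‖β⁻¹ • ∑ i : MatsubaraIdx M, ∫ p : ℝ × ℝ,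
        klfb_integrand δ μ (A i) f d e' (matsubaraFreq β M i) (2 * Real.pi * (m₀ : ℝ) / β) p‖ ≤
      2 * Real.pi * (512 / Real.pi * Mf * (A₀ * (Real.pi * Real.sqrt 2 / (B.Dtmin - κ₁)) * M') *
        min 1 (8 * klScale klE0 n / |2 * Real.pi * (m₀ : ℝ) / β|)) := by
  have hδc : Continuous δ := hδ1.continuous
  have hΛ := klth_klScale_pos n
  have hβ0 : 0 < β := pos_of_klBetaMin_le hβ
  have hr₁ : 0 < klScale klE0 n / 2 := by positivity
  have hr : 0 < 4 * klScale klE0 n := by positivity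
  have hν0 : ∀ i : MatsubaraIdx M, matsubaraFreq β M i + 2 * Real.pi * (m₀ : ℝ) / β ≠ 0 := by
    intro i
    rw [klhp_matsubaraFreq_add_bosonic β M i m₀]
    have hodd : (2 * ((matsubaraInt M i + m₀ : ℤ) : ℝ) + 1) ≠ 0 := by
      have h : (2 * (matsubaraInt M i + m₀) + 1 : ℤ) ≠ 0 := by omega
      exact_mod_cast h
    exact div_ne_zero (mul_ne_zero Real.pi_pos.ne' hodd) hβ0.ne'
  have hint : ∀ i : MatsubaraIdx M,
      Integrable (klfb_integrand δ μ (A i) f d e' (matsubaraFreq β M i) (2 * Real.pi * (m₀ : ℝ) / β)) := by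
    intro i
    have hc := klhp_continuous_integrand hδc (hA i) hlip hbd hin hout hr₁ hr hdlip he' μ (hν0 i)
    refine hc.integrable_of_hasCompactSupport ?_
    unfold klfb_integrand
    exact ((klfb_hasCompactSupport_of_square (hAsupp i)).mul_right).mul_right
  exact klry_norm_smul_sum_integral_le_of_ray_bound hint fun θ _ =>
    klhp_ray_soft_signblind_profile_le B hδ1 hδ hκ hκ₁ hA hAsupp hA00 hA0 hlip hbd hin hout hdlip hdbd he' θ (hσ θ) hlo hhi hβ hn hm₀

end Frame

/-! ## §3 On the model carrier: the lattice step from any planar bound, and the profile -/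

section Lattice

variable {a' b' : ℝ} (B : BandBounds a' b') {δ : (Fin 2 → ℝ) → ℝ} (hδ1 : ContDiff ℝ 1 δ) {κ₀ κ₁ : ℝ}
  (hδ : ∀ k : Fin 2 → ℝ, (∀ i, |k i| ≤ π) → |δ k| ≤ κ₀)
  (hκ : ∀ k : Fin 2 → ℝ, (∀ i, |k i| ≤ π) → ‖fderiv ℝ δ k‖ ≤ κ₁) (hκ₁ : κ₁ < B.Dtmin)

omit B in
/-- **The lattice step alone**: with the data of `klhl_lattice_soft_signblind_norm_le` (no ray-shift hypothesis needed here) and ANY planar bound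
`Bp` on the cut-off family `klfb_integrand δ μ (a_i·ψ) f d ẽ′ (ω_i) (2πm₀/β)`, the lattice bubble is `≤ (2π)⁻²·Bp + 32Λ_n·K/L`. -/
theorem klhl_lattice_soft_of_planar_bound
    {M : ℕ} {a : MatsubaraIdx M → ℝ × ℝ → ℂ} (ha : ∀ i, Continuous (a i)) (ha1 : ∀ i x y, a i (x + 2 * π, y) = a i (x, y))
    (ha2 : ∀ i x y, a i (x, y + 2 * π) = a i (x, y))
    {A₀ La : ℝ} (hA00 : 0 ≤ A₀) (hA0 : ∀ i p, ‖a i p‖ ≤ A₀) (hLa0 : 0 ≤ La) (hLa : ∀ i p q, ‖a i p - a i q‖ ≤ La * dist p q)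
    {eb : ℝ × ℝ → ℝ} (hebc : Continuous eb) (heb1 : ∀ x y, eb (x + 2 * π, y) = eb (x, y)) (heb2 : ∀ x y, eb (x, y + 2 * π) = eb (x, y))
    {Le : ℝ} (hLe : ∀ p q, |eb p - eb q| ≤ Le * dist p q) {μ : ℝ} (heb : ∀ p ∈ Icc (-π) π ×ˢ Icc (-π) π, eb p = klfb_band δ μ p)
    {eb' : ℝ × ℝ → ℝ} (heb'c : Continuous eb') (heb'1 : ∀ x y, eb' (x + 2 * π, y) = eb' (x, y)) (heb'2 : ∀ x y, eb' (x, y + 2 * π) = eb' (x, y))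
    {Le' : ℝ} (hLe' : ∀ p q, |eb' p - eb' q| ≤ Le' * dist p q)
    {zm : ℝ} (hzm : 0 < zm) {n : ℕ}
    (hzone : ∀ p ∈ Icc (-π) π ×ˢ Icc (-π) π, |eb p| < 4 * klScale klE0 n → |p.1| ≤ π - 2 * zm ∧ |p.2| ≤ π - 2 * zm)
    {f d : ℝ → ℂ} {Lf Mf ℓf Ld M' : ℝ}
    (hlip : ∀ s s', ‖f s - f s'‖ ≤ Lf * |s - s'|) (hbd : ∀ s, ‖f s‖ ≤ Mf) (hLf : Lf ≤ ℓf / klScale klE0 n ^ 2)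
    (hin : ∀ s, s ≤ (klScale klE0 n / 2) ^ 2 → f s = 0) (hout : ∀ s, (4 * klScale klE0 n) ^ 2 ≤ s → f s = 0)
    (hdlip : ∀ s s', ‖d s - d s'‖ ≤ Ld * |s - s'|) (hdbd : ∀ s, ‖d s‖ ≤ M')
    {β : ℝ} (hβ : klBetaMin ≤ β) (hn : n ≤ nScales β + 1) (m₀ : ℤ) {Bp : ℝ}
    (hBp : ‖β⁻¹ • ∑ i : MatsubaraIdx M, ∫ p : ℝ × ℝ,
        klfb_integrand δ μ (fun p => a i p * (klfl_squareCut zm p : ℂ)) f d eb' (matsubaraFreq β M i) (2 * Real.pi * (m₀ : ℝ) / β) p‖ ≤ Bp)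
    (L : ℕ) [NeZero L] :
    ‖β⁻¹ • ∑ i : MatsubaraIdx M, ((L ^ 2 : ℕ) : ℝ)⁻¹ • ∑ k : TorusSite 2 L,
        a i (latticeMomentum L k 0, latticeMomentum L k 1) *
          klfb_prop f (matsubaraFreq β M i) (eb (latticeMomentum L k 0, latticeMomentum L k 1)) *
            klfb_prop d (matsubaraFreq β M i + 2 * Real.pi * (m₀ : ℝ) / β) (eb' (latticeMomentum L k 0, latticeMomentum L k 1))‖ ≤
      ((2 * π) ^ 2)⁻¹ * Bp +
        32 * klScale klE0 n *
            (La * (2 * Mf / klScale klE0 n) * (M' * β / Real.pi) +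
              A₀ * ((9 * ℓf + 4 * Mf) / klScale klE0 n ^ 2 * Le) * (M' * β / Real.pi) +
              A₀ * (2 * Mf / klScale klE0 n) * ((2 * Ld + M' * β ^ 2 / Real.pi ^ 2) * Le')) / L := by
  have hΛ := klth_klScale_pos n
  have hβ0 : 0 < β := pos_of_klBetaMin_le hβ
  have hπ := Real.pi_pos
  have hr₁ : 0 < klScale klE0 n / 2 := by positivity
  have hr : 0 < 4 * klScale klE0 n := by positivity
  have hMf : 0 ≤ Mf := (norm_nonneg _).trans (hbd 0)
  have hM' : 0 ≤ M' := (norm_nonneg _).trans (hdbd 0)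
  have hLd : 0 ≤ Ld := by
    have := hdlip 0 1; have h0 : (0:ℝ) ≤ ‖d 0 - d 1‖ := norm_nonneg _; norm_num at this; linarith
  have hLe0 : 0 ≤ Le := by
    have h := hLe (1, 0) (0, 0)
    have hdist : (0 : ℝ) < dist ((1 : ℝ), (0 : ℝ)) ((0 : ℝ), (0 : ℝ)) := by rw [Prod.dist_eq]; simp
    exact nonneg_of_mul_nonneg_left ((abs_nonneg _).trans h) hdist
  have hLe'0 : 0 ≤ Le' := by
    have h := hLe' (1, 0) (0, 0)
    have hdist : (0 : ℝ) < dist ((1 : ℝ), (0 : ℝ)) ((0 : ℝ), (0 : ℝ)) := by rw [Prod.dist_eq]; simp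
    exact nonneg_of_mul_nonneg_left ((abs_nonneg _).trans h) hdist
  have hℓf : 0 ≤ 9 * ℓf + 4 * Mf := by
    have hLf0 : 0 ≤ Lf := by have := hlip 0 1; norm_num at this; linarith [norm_nonneg (f 0 - f 1)]
    have : 0 ≤ ℓf := by
      have h := hLf0.trans hLf; rwa [le_div_iff₀ (by positivity), zero_mul] at h
    positivity
  set q₀ : ℝ := 2 * Real.pi * (m₀ : ℝ) / β with hq₀
  -- the partner frequencies are fermionic: `|ν_i| ≥ π/β`
  have hν : ∀ i : MatsubaraIdx M, matsubaraFreq β M i + q₀ = Real.pi * (2 * ((matsubaraInt M i + m₀ : ℤ) : ℝ) + 1) / β :=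
    fun i => klhp_matsubaraFreq_add_bosonic β M i m₀
  have hνabs : ∀ i : MatsubaraIdx M, Real.pi / β ≤ |matsubaraFreq β M i + q₀| := by
    intro i
    rw [hν i, abs_div, abs_of_pos hβ0, abs_mul, abs_of_pos hπ]
    refine div_le_div_of_nonneg_right ?_ hβ0.le
    have hodd : (1 : ℝ) ≤ |2 * ((matsubaraInt M i + m₀ : ℤ) : ℝ) + 1| := by
      have h : (1 : ℤ) ≤ |2 * (matsubaraInt M i + m₀) + 1| := by
        rcases le_or_gt 0 (matsubaraInt M i + m₀) with h0 | h0
        · rw [abs_of_nonneg (by omega)]; omega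
        · rw [abs_of_neg (by omega)]; omega
      exact_mod_cast h
    nlinarith
  have hν0 : ∀ i : MatsubaraIdx M, matsubaraFreq β M i + q₀ ≠ 0 := fun i h => by
    have := hνabs i; rw [h, abs_zero] at this; linarith [div_pos hπ hβ0]
  -- the planar weights `A_i = a_i·ψ`
  set A : MatsubaraIdx M → ℝ × ℝ → ℂ := fun i p => a i p * (klfl_squareCut zm p : ℂ) with hAdef
  have hψbd : ∀ p, ‖(klfl_squareCut zm p : ℂ)‖ ≤ 1 := fun p => by
    rw [Complex.norm_real, Real.norm_of_nonneg (klfl_squareCut_mem zm p).1]; exact (klfl_squareCut_mem zm p).2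
  have hAc : ∀ i, Continuous (A i) := fun i => (ha i).mul (Complex.continuous_ofReal.comp (klfl_continuous_squareCut zm))
  have hAsupp : ∀ i, ∀ p : ℝ × ℝ, A i p ≠ 0 → |p.1| < π ∧ |p.2| < π := by
    intro i p hp
    have hψ : klfl_squareCut zm p ≠ 0 := fun h0 => hp (by simp only [hAdef, h0, Complex.ofReal_zero, mul_zero])
    obtain ⟨h1, h2⟩ := klfl_abs_lt_of_squareCut_ne_zero hzm hψ
    exact ⟨by linarith, by linarith⟩
  have hAbd : ∀ i p, ‖A i p‖ ≤ A₀ := fun i p => by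
    simp only [hAdef]; rw [norm_mul]
    calc ‖a i p‖ * ‖(klfl_squareCut zm p : ℂ)‖ ≤ A₀ * 1 := mul_le_mul (hA0 i p) (hψbd p) (norm_nonneg _) hA00
      _ = A₀ := mul_one _
  -- the periodic family and its properties
  set F : MatsubaraIdx M → ℝ × ℝ → ℂ := fun i p =>
    a i p * klfb_prop f (matsubaraFreq β M i) (eb p) * klfb_prop d (matsubaraFreq β M i + q₀) (eb' p) with hFdef
  have hΦc : ∀ k₀, Continuous fun e => klfb_prop f k₀ e := fun k₀ => klfb_continuous_prop_snd hlip hbd hin hout hr₁ hr k₀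
  have hΨc : ∀ i, Continuous fun e => klfb_prop d (matsubaraFreq β M i + q₀) e := fun i => klhp_continuous_prop_of_ne hdlip (hν0 i)
  have hFc : ∀ i, Continuous (F i) := fun i => ((ha i).mul ((hΦc _).comp hebc)).mul ((hΨc i).comp heb'c)
  have hF1 : ∀ i x y, F i (x + 2 * π, y) = F i (x, y) := fun i x y => by simp only [hFdef, ha1, heb1, heb'1]
  have hF2 : ∀ i x y, F i (x, y + 2 * π) = F i (x, y) := fun i x y => by simp only [hFdef, ha2, heb2, heb'2]
  -- β-dependent sup and Lipschitz constants of the soft partner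
  have hsupD : ∀ i e, ‖klfb_prop d (matsubaraFreq β M i + q₀) e‖ ≤ M' * β / Real.pi := by
    intro i e
    refine (klhl_soft_prop_norm_le hdbd (hν0 i) e).trans ?_
    rw [div_le_iff₀ (lt_of_lt_of_le (div_pos hπ hβ0) (hνabs i))]
    calc M' = M' * β / Real.pi * (Real.pi / β) := by field_simp
      _ ≤ M' * β / Real.pi * |matsubaraFreq β M i + q₀| := mul_le_mul_of_nonneg_left (hνabs i) (by positivity)
  have hlipD : ∀ i e e', ‖klfb_prop d (matsubaraFreq β M i + q₀) e - klfb_prop d (matsubaraFreq β M i + q₀) e'‖ ≤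
      (2 * Ld + M' * β ^ 2 / Real.pi ^ 2) * |e - e'| := by
    intro i e e'
    refine (klhl_soft_prop_lipschitz_snd hdlip hdbd (hν0 i) e e').trans (mul_le_mul_of_nonneg_right ?_ (abs_nonneg _))
    have h1 : (Real.pi / β) ^ 2 ≤ (matsubaraFreq β M i + q₀) ^ 2 := by
      rw [← sq_abs (matsubaraFreq β M i + q₀)]
      exact pow_le_pow_left₀ (by positivity) (hνabs i) 2
    have h2 : M' / (matsubaraFreq β M i + q₀) ^ 2 ≤ M' / (Real.pi / β) ^ 2 := div_le_div_of_nonneg_left hM' (by positivity) h1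
    have h3 : M' / (Real.pi / β) ^ 2 = M' * β ^ 2 / Real.pi ^ 2 := by field_simp
    linarith
  set K : ℝ := La * (2 * Mf / klScale klE0 n) * (M' * β / Real.pi) +
    A₀ * ((9 * ℓf + 4 * Mf) / klScale klE0 n ^ 2 * Le) * (M' * β / Real.pi) +
    A₀ * (2 * Mf / klScale klE0 n) * ((2 * Ld + M' * β ^ 2 / Real.pi ^ 2) * Le') with hKdef
  have hK0 : 0 ≤ K := by rw [hKdef]; positivity
  have hFlip' : ∀ i (p q : ℝ × ℝ), ‖F i p - F i q‖ ≤ (K.toNNReal : ℝ) * dist p q := by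
    intro i p q
    rw [Real.coe_toNNReal _ hK0]
    have hv : ∀ p q : ℝ × ℝ, ‖klfb_prop f (matsubaraFreq β M i) (eb p) - klfb_prop f (matsubaraFreq β M i) (eb q)‖ ≤
        (9 * ℓf + 4 * Mf) / klScale klE0 n ^ 2 * Le * dist p q :=
      fun p q => (klfl_prop_lipschitz_snd hlip hbd hLf hin hout (matsubaraFreq β M i) (eb p) (eb q)).trans (by
        rw [mul_assoc]; exact mul_le_mul_of_nonneg_left (hLe p q) (by positivity))
    have hw : ∀ p q : ℝ × ℝ, ‖klfb_prop d (matsubaraFreq β M i + q₀) (eb' p) - klfb_prop d (matsubaraFreq β M i + q₀) (eb' q)‖ ≤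
        (2 * Ld + M' * β ^ 2 / Real.pi ^ 2) * Le' * dist p q :=
      fun p q => (hlipD i (eb' p) (eb' q)).trans (by
        rw [mul_assoc]; exact mul_le_mul_of_nonneg_left (hLe' p q) (by positivity))
    exact klfl_lipschitz_triple (u := a i) (v := fun p => klfb_prop f (matsubaraFreq β M i) (eb p))
      (w := fun p => klfb_prop d (matsubaraFreq β M i + q₀) (eb' p))
      (hA0 i) (fun p => klfl_prop_norm_le hbd hin (matsubaraFreq β M i) (eb p)) (fun p => hsupD i (eb' p)) (hLa i) hv hw p q
  have hFh : ∀ i, ∀ p ∈ Icc (-π) π ×ˢ Icc (-π) π, F i p = klfb_integrand δ μ (A i) f d eb' (matsubaraFreq β M i) q₀ p :=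
    fun i p hp => klfl_integrand_eq_on_square hzm heb hzone hout (matsubaraFreq β M i) q₀ hp
  have hh0 : ∀ i, ∀ p ∉ Icc (-π) π ×ˢ Icc (-π) π, klfb_integrand δ μ (A i) f d eb' (matsubaraFreq β M i) q₀ p = 0 :=
    fun i p hp => klfl_integrand_eq_zero_off_square hzm (matsubaraFreq β M i) q₀ hp
  have hzero : ∀ i, 4 * klScale klE0 n ≤ |matsubaraFreq β M i| → ∀ p, F i p = 0 := by
    intro i hi p
    simp only [hFdef]
    rw [klfl_prop_eq_zero_of_le_abs_fst hout hi, mul_zero, zero_mul]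
  have h := klfl_matsubara_latticeAverage_norm_le_scale (F := F) (h := fun i => klfb_integrand δ μ (A i) f d eb' (matsubaraFreq β M i) q₀)
    hβ hn hFc hF1 hF2 hFlip' hFh hh0 hzero hBp L
  rw [Real.coe_toNNReal _ hK0] at h
  exact h


include B hδ1 hδ hκ hκ₁ in
/-- **THE FREQUENCY PROFILE ON THE MODEL CARRIER**: as `klhl_lattice_soft_signblind_norm_le` with `m₀ ≠ 0`, main term × `min(1, 8Λ_n/|2πm₀/β|)`. -/
theorem klhl_lattice_soft_signblind_profile_le
    {M : ℕ} {a : MatsubaraIdx M → ℝ × ℝ → ℂ} (ha : ∀ i, Continuous (a i)) (ha1 : ∀ i x y, a i (x + 2 * π, y) = a i (x, y))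
    (ha2 : ∀ i x y, a i (x, y + 2 * π) = a i (x, y))
    {A₀ La : ℝ} (hA00 : 0 ≤ A₀) (hA0 : ∀ i p, ‖a i p‖ ≤ A₀) (hLa0 : 0 ≤ La) (hLa : ∀ i p q, ‖a i p - a i q‖ ≤ La * dist p q)
    {eb : ℝ × ℝ → ℝ} (hebc : Continuous eb) (heb1 : ∀ x y, eb (x + 2 * π, y) = eb (x, y)) (heb2 : ∀ x y, eb (x, y + 2 * π) = eb (x, y))
    {Le : ℝ} (hLe : ∀ p q, |eb p - eb q| ≤ Le * dist p q) {μ : ℝ} (heb : ∀ p ∈ Icc (-π) π ×ˢ Icc (-π) π, eb p = klfb_band δ μ p)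
    {eb' : ℝ × ℝ → ℝ} (heb'c : Continuous eb') (heb'1 : ∀ x y, eb' (x + 2 * π, y) = eb' (x, y)) (heb'2 : ∀ x y, eb' (x, y + 2 * π) = eb' (x, y))
    {Le' : ℝ} (hLe' : ∀ p q, |eb' p - eb' q| ≤ Le' * dist p q)
    {zm : ℝ} (hzm : 0 < zm) {n : ℕ}
    (hzone : ∀ p ∈ Icc (-π) π ×ˢ Icc (-π) π, |eb p| < 4 * klScale klE0 n → |p.1| ≤ π - 2 * zm ∧ |p.2| ≤ π - 2 * zm)
    (hσ : ∀ θ : ℝ, ∀ e ∈ Icc (-(4 * klScale klE0 n)) (4 * klScale klE0 n), ∀ e'' ∈ Icc (-(4 * klScale klE0 n)) (4 * klScale klE0 n),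
      |klfb_shift δ μ eb' θ e - klfb_shift δ μ eb' θ e''| ≤ |e - e''| / 2)
    {f d : ℝ → ℂ} {Lf Mf ℓf Ld M' : ℝ}
    (hlip : ∀ s s', ‖f s - f s'‖ ≤ Lf * |s - s'|) (hbd : ∀ s, ‖f s‖ ≤ Mf) (hLf : Lf ≤ ℓf / klScale klE0 n ^ 2)
    (hin : ∀ s, s ≤ (klScale klE0 n / 2) ^ 2 → f s = 0) (hout : ∀ s, (4 * klScale klE0 n) ^ 2 ≤ s → f s = 0)
    (hdlip : ∀ s s', ‖d s - d s'‖ ≤ Ld * |s - s'|) (hdbd : ∀ s, ‖d s‖ ≤ M')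
    (hlo : a' < μ - 4 * klScale klE0 n - κ₀) (hhi : μ + 4 * klScale klE0 n + κ₀ < b')
    {β : ℝ} (hβ : klBetaMin ≤ β) (hn : n ≤ nScales β + 1) {m₀ : ℤ} (hm₀ : m₀ ≠ 0) (L : ℕ) [NeZero L] :
    ‖β⁻¹ • ∑ i : MatsubaraIdx M, ((L ^ 2 : ℕ) : ℝ)⁻¹ • ∑ k : TorusSite 2 L,
        a i (latticeMomentum L k 0, latticeMomentum L k 1) *
          klfb_prop f (matsubaraFreq β M i) (eb (latticeMomentum L k 0, latticeMomentum L k 1)) *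
            klfb_prop d (matsubaraFreq β M i + 2 * Real.pi * (m₀ : ℝ) / β) (eb' (latticeMomentum L k 0, latticeMomentum L k 1))‖ ≤
      ((2 * π) ^ 2)⁻¹ * (2 * Real.pi * (512 / Real.pi * Mf * (A₀ * (Real.pi * Real.sqrt 2 / (B.Dtmin - κ₁)) * M') *
        min 1 (8 * klScale klE0 n / |2 * Real.pi * (m₀ : ℝ) / β|))) +
        32 * klScale klE0 n *
            (La * (2 * Mf / klScale klE0 n) * (M' * β / Real.pi) +
              A₀ * ((9 * ℓf + 4 * Mf) / klScale klE0 n ^ 2 * Le) * (M' * β / Real.pi) +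
              A₀ * (2 * Mf / klScale klE0 n) * ((2 * Ld + M' * β ^ 2 / Real.pi ^ 2) * Le')) / L := by
  -- the planar weights `A_i = a_i·ψ` and the planar profile bound
  have hψbd : ∀ p, ‖(klfl_squareCut zm p : ℂ)‖ ≤ 1 := fun p => by
    rw [Complex.norm_real, Real.norm_of_nonneg (klfl_squareCut_mem zm p).1]; exact (klfl_squareCut_mem zm p).2
  have hAc : ∀ i, Continuous (fun p => a i p * (klfl_squareCut zm p : ℂ)) :=
    fun i => (ha i).mul (Complex.continuous_ofReal.comp (klfl_continuous_squareCut zm))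
  have hAsupp : ∀ i, ∀ p : ℝ × ℝ, a i p * (klfl_squareCut zm p : ℂ) ≠ 0 → |p.1| < π ∧ |p.2| < π := by
    intro i p hp
    have hψ : klfl_squareCut zm p ≠ 0 := fun h0 => hp (by simp only [h0, Complex.ofReal_zero, mul_zero])
    obtain ⟨h1, h2⟩ := klfl_abs_lt_of_squareCut_ne_zero hzm hψ
    exact ⟨by linarith, by linarith⟩
  have hAbd : ∀ i p, ‖a i p * (klfl_squareCut zm p : ℂ)‖ ≤ A₀ := fun i p => by
    rw [norm_mul]
    calc ‖a i p‖ * ‖(klfl_squareCut zm p : ℂ)‖ ≤ A₀ * 1 := mul_le_mul (hA0 i p) (hψbd p) (norm_nonneg _) hA00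
      _ = A₀ := mul_one _
  have hBp := klhp_planar_soft_signblind_profile_le B hδ1 hδ hκ hκ₁ (A := fun i p => a i p * (klfl_squareCut zm p : ℂ)) hAc hAsupp hA00 hAbd
    hlip hbd hin hout hdlip hdbd heb'c hσ hlo hhi hβ hn hm₀
  exact klhl_lattice_soft_of_planar_bound ha ha1 ha2 hA00 hA0 hLa0 hLa hebc heb1 heb2 hLe heb heb'c heb'1 heb'2 hLe' hzm hzone
    hlip hbd hLf hin hout hdlip hdbd hβ hn m₀ hBp L

end Lattice

end Summit.HubbardSuperconductivity.HubbardSuperconductivity.Theorems.KLRegimeSplit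

end
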